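import Literature.NumberTheory.Automorphic.LevelControlFiniteLevel
import Mathlib.LinearAlgebra.TensorProduct.RightExactness
import HarnessLib

/-!
# Finite-level control without flatness: split coefficient sequences

Topic `NumberTheory/Automorphic`; namespace `Literature.NumberTheory.Automorphic.LevelAction`;
definitions with bodies (two retractions) and theorems; no named fact, no `sorry`.

`LevelControlInduced` / `LevelControlFiniteLevel` assume the coefficient module `V` flat over `R`,
only to tensor the short exact sequences of `Q`-modules `0 → R → R[Q] → C → 0` and
`0 → I_Q → R[Q] → R → 0` with `V`.  Both sequences are SPLIT as sequences of `R`-modules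
(`unitRetraction`: evaluation at `1`; `augRetraction`: `φ ↦ φ − ε(φ) δ_1`), so they stay exact after
`- ⊗ V` for EVERY `V` (`shortExact_inducedMap_of_retraction`: right exactness of `⊗` plus the
retraction), and the two consequences used by Hida's control theorem hold without flatness — in
particular for the non-flat coefficients `ℤ/p^s` over `ℤ`:

* `ker_resCohomology_le_ker_pow_heckeCohomology` — `ker res ≤ ker [U'αU']^m` as soon as `(U^𝓕)^m`
  kills `Hⁱ(𝓕 C)` (`i + 1 = j`);
* `range_trCohomology_eq_top` — `tr : Hʲ(U, τ) → Hʲ(U', τ)` is onto if `Hʲ⁺¹(𝓕 I_Q) = 0`.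

[cite: KhareThorne2017, §6.3, Prop. 6.6 and Lemma 6.9] [cite: Hida1994AIF, §3, Thm 3.2]

## References

* C. Khare, J. A. Thorne, Amer. J. Math. 139 (2017), §6.3. [KhareThorne2017]
* H. Hida, Ann. Inst. Fourier 44 (1994), §3. [Hida1994AIF]
-/

noncomputable section

open CategoryTheory groupCohomology
open scoped TensorProduct

namespace Literature.NumberTheory.Automorphic

namespace LevelAction

/-! ### Retractions of `η : R → R[Q]` and `I_Q ↪ R[Q]` -/

section Retractions

variable (R : Type) [CommRing R] (Q : Type) [Group Q]

/-- Evaluation at `1`, a retraction of `unitMap : R → Fun(Q, R)`. [folklore] -/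
def unitRetraction : (Q → R) →ₗ[R] R :=
  LinearMap.proj 1

/-- `ev₁ ∘ η = id`. [folklore] -/
theorem unitRetraction_comp_unitMap : unitRetraction R Q ∘ₗ unitMap R Q = LinearMap.id :=
  LinearMap.ext fun _ => rfl

variable [Fintype Q] [DecidableEq Q]

/-- `φ ↦ φ − ε(φ) δ_1`, a retraction of the inclusion `I_Q = ker ε ↪ Fun(Q, R)`. [folklore] -/
def augRetraction : (Q → R) →ₗ[R] LinearMap.ker (augMap R Q) :=
  LinearMap.codRestrict _ (LinearMap.id - (LinearMap.lsmul R (Q → R)).flip (Pi.single 1 1) ∘ₗ augMap R Q)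
    fun φ => by
      rw [LinearMap.mem_ker, LinearMap.sub_apply, map_sub, LinearMap.id_apply, LinearMap.comp_apply,
        LinearMap.flip_apply, LinearMap.lsmul_apply, map_smul, augMap_single, smul_eq_mul, mul_one, sub_self]

/-- `r ∘ incl = id`. [folklore] -/
theorem augRetraction_comp_subtype :
    augRetraction R Q ∘ₗ (LinearMap.ker (augMap R Q)).subtype = LinearMap.id := by
  refine LinearMap.ext fun φ => Subtype.ext ?_
  rw [LinearMap.comp_apply, LinearMap.id_apply, augRetraction, LinearMap.codRestrict_apply,
    LinearMap.sub_apply, LinearMap.id_apply, LinearMap.comp_apply, Submodule.subtype_apply,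
    LinearMap.mem_ker.1 φ.2, map_zero, sub_zero]

end Retractions

/-! ### Short exactness of `𝓕` on split sequences -/

section Split

variable {R : Type} [CommRing R] {Γ 𝒢 : Type} [Group Γ] [Group 𝒢] (ι : Γ →* 𝒢)
  {Δ : Submonoid 𝒢} {V : Type} [AddCommGroup V] [Module R V] (τ : Δ →* Module.End R V)
  {U' : Subgroup 𝒢} (hU' : U'.toSubmonoid ≤ Δ) {Q : Type} [Group Q] (π : U' →* Q)
  {N N' N'' : Type} [AddCommGroup N] [Module R N] [AddCommGroup N'] [Module R N']
  [AddCommGroup N''] [Module R N'']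
  {ρ : Representation R Q N} {ρ' : Representation R Q N'} {ρ'' : Representation R Q N''}

/-- **`0 → 𝓕 N → 𝓕 N' → 𝓕 N'' → 0` is short exact for a short exact sequence of `Q`-modules whose
first map admits an `R`-linear retraction** (no flatness of `V` needed: right exactness of `⊗ V`
and `(r ⊗ 1) ∘ (φ ⊗ 1) = 1`). [cite: KhareThorne2017, §6.3 (Lemma 6.9)] -/
theorem shortExact_inducedMap_of_retraction (φ : N →ₗ[R] N') (ψ : N' →ₗ[R] N'')
    (hφ : ∀ q : Q, φ ∘ₗ ρ q = ρ' q ∘ₗ φ) (hψ : ∀ q : Q, ψ ∘ₗ ρ' q = ρ'' q ∘ₗ ψ)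
    (r : N' →ₗ[R] N) (hr : r ∘ₗ φ = LinearMap.id) (hsurj : Function.Surjective ψ) (hex : Function.Exact φ ψ) :
    (ShortComplex.mk (inducedMap ι τ hU' π ρ ρ' φ hφ) (inducedMap ι τ hU' π ρ' ρ'' ψ hψ)
      (inducedMap_comp_eq_zero ι τ hU' π φ ψ hφ hψ
        (LinearMap.ext fun v => (hex (φ v)).2 ⟨v, rfl⟩))).ShortExact := by
  have hinj : Function.Injective (φ.rTensor V) := by
    refine Function.LeftInverse.injective (g := r.rTensor V) fun x => ?_
    rw [← LinearMap.comp_apply, ← LinearMap.rTensor_comp, hr, LinearMap.rTensor_id, LinearMap.id_apply]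
  exact shortExact_pushforward ι _ _ _ level_le_self _ _ _ _ hinj
    (LinearMap.rTensor_surjective V hsurj) (rTensor_exact V hex hsurj)

/-- **`0 → 𝓕(R) → 𝓕(R[Q]) → 𝓕(C) → 0` is short exact for every `V`.** [cite: KhareThorne2017, §6.3] -/
theorem unitSC_shortExact' : (unitSC ι τ hU' π).ShortExact :=
  shortExact_inducedMap_of_retraction ι τ hU' π _ _ _ _ (unitRetraction R Q)
    (unitRetraction_comp_unitMap R Q) (Submodule.mkQ_surjective _) (exact_unitMap_mkQ R Q)

/-- **`0 → 𝓕(I_Q) → 𝓕(R[Q]) → 𝓕(R) → 0` is short exact for every `V`.** [cite: KhareThorne2017, §6.3] -/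
theorem augSC_shortExact' [Fintype Q] [DecidableEq Q] : (augSC ι τ hU' π).ShortExact :=
  shortExact_inducedMap_of_retraction ι τ hU' π _ _ _ _ (augRetraction R Q)
    (augRetraction_comp_subtype R Q) (augMap_surjective R Q) (exact_subtype_augMap R Q)

variable {J : Type} [Fintype J] {a : J → 𝒢}

/-- `K1'` without flatness: the kernel of `𝓕(η)_*` is killed by `U^m` if `U^m` kills `Hⁱ(𝓕 C)`.
[cite: KhareThorne2017, §6.3, Prop. 6.6] -/
theorem pow_inducedHeckeCohomology_apply_eq_zero_of_map_unit_eq_zero'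
    (ha : IsAdaptedFamily Δ U' π a) {i j : ℕ} (hij : i + 1 = j) {m : ℕ}
    (h₃ : ∀ y : inducedCohomology ι τ hU' π (cokerUnitRep R Q) i,
      (inducedHeckeCohomology ι τ hU' π ha i ^ m) y = 0)
    (x : inducedCohomology ι τ hU' π (Representation.trivial R Q R) j)
    (hx : (inducedMapCohomology ι τ hU' π _ _ (unitMap R Q) (unitMap_equivariant R Q) j).hom x = 0) :
    (inducedHeckeCohomology ι τ hU' π ha j ^ m) x = 0 :=
  LevelControl.pow_map_apply_eq_zero_of_map_f_eq_zero (unitSC_shortExact' ι τ hU' π)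
    (unitSCHecke ι τ hU' π ha) hij (m := m) h₃ x hx

/-- `K3'` without flatness: `𝓕(ε)_*` is onto if `Hʲ⁺¹(𝓕 I_Q) = 0`. [cite: KhareThorne2017, §6.3] -/
theorem map_inducedMap_augMap_surjective' [Fintype Q] [DecidableEq Q] (j : ℕ)
    [Subsingleton (inducedCohomology ι τ hU' π (augKerRep R Q) (j + 1))] :
    Function.Surjective
      (inducedMapCohomology ι τ hU' π _ _ (augMap R Q) (augMap_equivariant R Q) j).hom :=
  LevelControl.map_g_surjective_of_subsingleton (augSC_shortExact' ι τ hU' π) j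

end Split

/-! ### The two finite-level statements without flatness -/

section FiniteLevel

variable {R : Type} [CommRing R] {Γ 𝒢 : Type} [Group Γ] [Group 𝒢] (ι : Γ →* 𝒢)
  {Δ : Submonoid 𝒢} {V : Type} [AddCommGroup V] [Module R V]
  (τ : Δ →* Module.End R V)
  {U U' : Subgroup 𝒢} (hU : U.toSubmonoid ≤ Δ) (hU' : U'.toSubmonoid ≤ Δ) (hle : U ≤ U')
  {Q : Type} [Group Q] [Fintype Q] [DecidableEq Q] (π : U' →* Q)
  (hker : ∀ u : U', π u = 1 ↔ (u : 𝒢) ∈ U) (s : Q → U') (hs : ∀ q, π (s q) = q)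
  {J : Type} [Fintype J] {a : J → 𝒢} {α : 𝒢}

include hU hker s hs in
/-- **`ker res ≤ ker [U'αU']^m` as soon as `(U^𝓕)^m` kills `Hⁱ(𝓕 C)`** (`i + 1 = j`), for EVERY
coefficient module `V` (the flat case is `pow_heckeCohomology_apply_eq_zero_of_resCohomology_eq_zero`
of `LevelControlFiniteLevel`; here no flatness, e.g. `V = ℤ/p^s` over `ℤ`).
[cite: KhareThorne2017, §6.3, Prop. 6.6] [cite: Hida1994AIF, §3, Thm 3.2] -/
theorem ker_resCohomology_le_ker_pow_heckeCohomology (hα : α ∈ Δ)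
    (ha : IsAdaptedFamily Δ U' π a)
    (hbij' : Set.BijOn (fun j => ((a j : 𝒢) : 𝒢 ⧸ U')) Set.univ (ArithmeticQuotient.doubleCosetQuot U' α))
    {i j : ℕ} (hij : i + 1 = j) {m : ℕ}
    (h₃ : ∀ y : groupCohomology (inducedRep ι τ hU' π (cokerUnitRep R Q)) i,
      (inducedHeckeCohomology ι τ hU' π ha i ^ m) y = 0) :
    LinearMap.ker (resCohomology ι Δ τ hle j).hom ≤ LinearMap.ker (heckeCohomology ι Δ τ U' hU' hα j ^ m) := by
  intro x hx
  rw [LinearMap.mem_ker] at hx ⊢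
  have hx' : (inducedMapCohomology ι τ hU' π _ _ (unitMap R Q) (unitMap_equivariant R Q) j).hom
      ((map (MonoidHom.id Γ) (trivRepIso ι τ hU' π).hom j).hom x) = 0 := by
    rw [← map_hom_map_hom_eq (resRepHom_comp_shapiroIso_hom ι τ hU hU' hle π hker s hs) j x]
    change (map (MonoidHom.id Γ) (shapiroIso ι τ hU hU' hle π hker s hs).hom j).hom
      ((resCohomology ι Δ τ hle j).hom x) = 0
    rw [hx, map_zero]
  have hK := pow_inducedHeckeCohomology_apply_eq_zero_of_map_unit_eq_zero' ι τ hU' π ha hij h₃ _ hx'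
  have hcomm : ∀ y, inducedHeckeCohomology ι τ hU' π ha j
      ((map (MonoidHom.id Γ) (trivRepIso ι τ hU' π).hom j).hom y) =
        (map (MonoidHom.id Γ) (trivRepIso ι τ hU' π).hom j).hom (heckeCohomology ι Δ τ U' hU' hα j y) :=
    fun y => (map_hom_map_hom_eq (heckeRepHom_comp_trivRepIso_hom ι τ hU' π hα ha hbij') j y).symm
  rw [LevelControl.pow_apply_comp_eq _ _ _ hcomm m x] at hK
  exact (map_eq_zero_iff _
    ((groupCohomology.functor R Γ j).mapIso (trivRepIso ι τ hU' π)).toLinearEquiv.injective).1 hK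

include hle hker s hs in
/-- **`range tr = ⊤` for the transfer `tr : Hʲ(U, τ) → Hʲ(U', τ)` if `Hʲ⁺¹(𝓕 I_Q) = 0`**, for EVERY
coefficient module `V` (the flat case is `trCohomology_surjective` of `LevelControlFiniteLevel`).
[cite: KhareThorne2017, §6.3, Prop. 6.6] -/
theorem range_trCohomology_eq_top (j : ℕ)
    [Subsingleton (groupCohomology (inducedRep ι τ hU' π (augKerRep R Q)) (j + 1))] :
    LinearMap.range (trCohomology ι Δ τ hU hU' j).hom = ⊤ := by
  refine LinearMap.range_eq_top.2 fun z => ?_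
  obtain ⟨w', hw'⟩ := map_inducedMap_augMap_surjective' ι τ hU' π j
    ((map (MonoidHom.id Γ) (trivRepIso ι τ hU' π).hom j).hom z)
  refine ⟨(map (MonoidHom.id Γ) (shapiroIso ι τ hU hU' hle π hker s hs).inv j).hom w',
    ((groupCohomology.functor R Γ j).mapIso (trivRepIso ι τ hU' π)).toLinearEquiv.injective ?_⟩
  have h3 : (map (MonoidHom.id Γ) (shapiroIso ι τ hU hU' hle π hker s hs).hom j).hom
      ((map (MonoidHom.id Γ) (shapiroIso ι τ hU hU' hle π hker s hs).inv j).hom w') = w' :=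
    iso_hom_inv_apply ((groupCohomology.functor R Γ j).mapIso (shapiroIso ι τ hU hU' hle π hker s hs)) w'
  change (map (MonoidHom.id Γ) (trivRepIso ι τ hU' π).hom j).hom
      ((map (MonoidHom.id Γ) (trRepHom ι Δ τ hU hU') j).hom
        ((map (MonoidHom.id Γ) (shapiroIso ι τ hU hU' hle π hker s hs).inv j).hom w')) =
    (map (MonoidHom.id Γ) (trivRepIso ι τ hU' π).hom j).hom z
  rw [← map_hom_map_hom_eq (shapiroIso_hom_comp_inducedMap_augMap ι τ hU hU' hle π hker s hs) j, h3, hw']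

end FiniteLevel

end LevelAction

end Literature.NumberTheory.Automorphic
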